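import Summits.CriticalPhenomena.PercolationContinuityZ3.Theorems.PercNearOneGluingNoHeavyLowerTailForestConnMonotoneWeighted
import Summits.CriticalPhenomena.PercolationContinuityZ3.Theorems.PercNearOneGluingNoHeavyLowerTailForestEdgeExchange
import HarnessLib

/-!
# Weighted forest negative correlation on graphs of tree-width ≤ 2 — I: toolkit

Notation (never introduced as definitions; every statement spells the sums out). For an edge
type `α` with activities `w : α → ℝ`, a free set `D` and a pinned set `K` the *pinned partition
function* of a predicate `Q` is

  `Z_Q(D;K) = Σ_{G ⊆ D, Q(G ∪ K)} ∏_{g ∈ G} w g`,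

and for a finite simple edge system on `V` (`α = Sym2 V`, `Q = ⟨·⟩ acyclic`) `Z(D;K)` is the
weighted spanning-forest partition function of the minor `⟨D ∪ K⟩/K` (forests of `⟨D ∪ K⟩` that
contain `K`; a cycle inside `K` kills everything). The *Rayleigh / negative-correlation
inequality* for two further edges `e, f` is the log-submodularity of `K ↦ Z(D;K)`,

  `Z(D;K ∪ {e,f}) · Z(D;K) ≤ Z(D;K ∪ {e}) · Z(D;K ∪ {f})`                                  (R)

(Semple–Welsh's `I_{ef} I^{ef} ≤ I_e^f I_f^e`, Lemma 3.1 of *Negative correlation in graphs and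
matroids*, CPC 17 (2008), for the cycle matroid of `⟨D ∪ K ∪ {e,f}⟩/K`; at unit weights it is the
Grimmett–Winkler / Kahn forest negative-correlation inequality).

This file collects the local surgery facts used to push (R) through a vertex of degree ≤ 2
(pendant and series reductions, S–W Prop. 3.7 in graph language): congruence / vanishing /
monotonicity / re-weighting of pinned partition functions, and for forests: a pendant edge can be
pinned or freed (`(1 + w g)` factor), a second edge at a vertex whose first edge is pinned can be
re-routed to the chord, a pinned triangle kills the partition function.

Theorems only; no definitions, no `sorry`.
-/

open Finset SimpleGraph

namespace Summit.CriticalPhenomena.PercolationContinuityZ3.Theorems.ForestRayleigh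

/-! ### §1 Abstract pinned partition functions -/

section Abstract

variable {α : Type*} [DecidableEq α]

/-- Congruence of pinned partition functions in the pinned set: if `Q(G ∪ K) ↔ Q(G ∪ K')` for all
`G ⊆ D` then `Z_Q(D;K) = Z_Q(D;K')`. [elementary] -/
theorem sum_pinned_congr (w : α → ℝ) (Q : Finset α → Prop) [DecidablePred Q]
    (D K K' : Finset α) (h : ∀ G, G ⊆ D → (Q (G ∪ K) ↔ Q (G ∪ K'))) :
    ∑ G ∈ D.powerset.filter (fun G => Q (G ∪ K)), ∏ g ∈ G, w g =
      ∑ G ∈ D.powerset.filter (fun G => Q (G ∪ K')), ∏ g ∈ G, w g := by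
  apply Finset.sum_congr _ (fun _ _ => rfl)
  ext G
  simp only [Finset.mem_filter, Finset.mem_powerset]
  exact ⟨fun hG => ⟨hG.1, (h G hG.1).1 hG.2⟩, fun hG => ⟨hG.1, (h G hG.1).2 hG.2⟩⟩

/-- Congruence between two predicates on the same free/pinned pair. [elementary] -/
theorem sum_pinned_congr_pred (w : α → ℝ) (Q Q' : Finset α → Prop) [DecidablePred Q]
    [DecidablePred Q'] (D K : Finset α) (h : ∀ G, G ⊆ D → (Q (G ∪ K) ↔ Q' (G ∪ K))) :
    ∑ G ∈ D.powerset.filter (fun G => Q (G ∪ K)), ∏ g ∈ G, w g =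
      ∑ G ∈ D.powerset.filter (fun G => Q' (G ∪ K)), ∏ g ∈ G, w g := by
  apply Finset.sum_congr _ (fun _ _ => rfl)
  ext G
  simp only [Finset.mem_filter, Finset.mem_powerset]
  exact ⟨fun hG => ⟨hG.1, (h G hG.1).1 hG.2⟩, fun hG => ⟨hG.1, (h G hG.1).2 hG.2⟩⟩

/-- A pinned partition function vanishes when no `G ⊆ D` satisfies `Q(G ∪ K)` (e.g. the pinned
set already contains a cycle). [elementary] -/
theorem sum_pinned_eq_zero (w : α → ℝ) (Q : Finset α → Prop) [DecidablePred Q]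
    (D K : Finset α) (h : ∀ G, G ⊆ D → ¬Q (G ∪ K)) :
    ∑ G ∈ D.powerset.filter (fun G => Q (G ∪ K)), ∏ g ∈ G, w g = 0 := by
  apply Finset.sum_eq_zero
  intro G hG
  simp only [Finset.mem_filter, Finset.mem_powerset] at hG
  exact absurd hG.2 (h G hG.1)

/-- Monotonicity in the pinned set for nonnegative activities: if `Q(G ∪ K') → Q(G ∪ K)` on
`G ⊆ D` then `Z_Q(D;K') ≤ Z_Q(D;K)`. [elementary] -/
theorem sum_pinned_mono (w : α → ℝ) (hw : ∀ a, 0 ≤ w a) (Q : Finset α → Prop) [DecidablePred Q]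
    (D K K' : Finset α) (h : ∀ G, G ⊆ D → Q (G ∪ K') → Q (G ∪ K)) :
    ∑ G ∈ D.powerset.filter (fun G => Q (G ∪ K')), ∏ g ∈ G, w g ≤
      ∑ G ∈ D.powerset.filter (fun G => Q (G ∪ K)), ∏ g ∈ G, w g :=
  Finset.sum_le_sum_of_subset_of_nonneg
    (fun G hG => by
      simp only [Finset.mem_filter, Finset.mem_powerset] at hG ⊢
      exact ⟨hG.1, h G hG.1 hG.2⟩)
    (fun G _ _ => Finset.prod_nonneg fun g _ => hw g)

/-- Changing the activity of a coordinate outside the free set does not change a pinned partition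
function. [elementary] -/
theorem sum_pinned_update (w : α → ℝ) (Q : Finset α → Prop) [DecidablePred Q] (D K : Finset α)
    (h : α) (c : ℝ) (hh : h ∉ D) :
    ∑ G ∈ D.powerset.filter (fun G => Q (G ∪ K)), ∏ g ∈ G, Function.update w h c g =
      ∑ G ∈ D.powerset.filter (fun G => Q (G ∪ K)), ∏ g ∈ G, w g := by
  apply Finset.sum_congr rfl
  intro G hG
  simp only [Finset.mem_filter, Finset.mem_powerset] at hG
  apply Finset.prod_congr rfl
  intro g hg
  have hne : g ≠ h := fun hgh => hh (hgh ▸ hG.1 hg)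
  exact Function.update_of_ne hne c w

/-- The updated activity is nonnegative if the old ones and the new value are. [elementary] -/
theorem update_nonneg (w : α → ℝ) (hw : ∀ a, 0 ≤ w a) (h : α) {c : ℝ} (hc : 0 ≤ c) :
    ∀ a, 0 ≤ Function.update w h c a := by
  intro a
  rcases eq_or_ne a h with rfl | hne
  · rw [Function.update_self]; exact hc
  · rw [Function.update_of_ne hne]; exact hw a

/-- **Freeing an irrelevant coordinate.** If `g ∉ D` and pinning `g` does not change `Q` on the
sets `G ∪ K`, `G ⊆ D`, then `Z_Q(D ∪ g;K) = (1 + w g) · Z_Q(D;K)`. [elementary] -/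
theorem sum_pinned_insert_free (w : α → ℝ) (Q : Finset α → Prop) [DecidablePred Q]
    (D K : Finset α) {g : α} (hg : g ∉ D)
    (h : ∀ G, G ⊆ D → (Q (G ∪ insert g K) ↔ Q (G ∪ K))) :
    ∑ G ∈ (insert g D).powerset.filter (fun G => Q (G ∪ K)), ∏ x ∈ G, w x =
      (1 + w g) * ∑ G ∈ D.powerset.filter (fun G => Q (G ∪ K)), ∏ x ∈ G, w x := by
  rw [ConnMonotone.sum_pinned_split w Q (insert g D) K (Finset.mem_insert_self g D),
    Finset.erase_insert hg, sum_pinned_congr w Q D (insert g K) K h]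
  ring

/-- Splitting off a free coordinate `g ∉ D`: `Z_Q(D ∪ g;K) = Z_Q(D;K) + w g · Z_Q(D;K ∪ g)`.
[elementary] -/
theorem sum_pinned_insert_split (w : α → ℝ) (Q : Finset α → Prop) [DecidablePred Q]
    (D K : Finset α) {g : α} (hg : g ∉ D) :
    ∑ G ∈ (insert g D).powerset.filter (fun G => Q (G ∪ K)), ∏ x ∈ G, w x =
      ∑ G ∈ D.powerset.filter (fun G => Q (G ∪ K)), ∏ x ∈ G, w x +
        w g * ∑ G ∈ D.powerset.filter (fun G => Q (G ∪ insert g K)), ∏ x ∈ G, w x := by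
  rw [ConnMonotone.sum_pinned_split w Q (insert g D) K (Finset.mem_insert_self g D),
    Finset.erase_insert hg]

end Abstract

/-! ### §2 Forest surgery at a vertex of degree ≤ 2 -/

section Forests
open scoped Classical

variable {V : Type*} [Fintype V] [DecidableEq V]

omit [Fintype V] [DecidableEq V] in
/-- Sub-systems of acyclic edge systems are acyclic. [folklore] -/
theorem isAcyclic_of_subset {X Y : Finset (Sym2 V)} (hXY : X ⊆ Y)
    (hY : (fromEdgeSet ((Y : Finset (Sym2 V)) : Set (Sym2 V))).IsAcyclic) :
    (fromEdgeSet ((X : Finset (Sym2 V)) : Set (Sym2 V))).IsAcyclic :=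
  hY.anti (fromEdgeSet_mono (Finset.coe_subset.2 hXY))

omit [Fintype V] [DecidableEq V] in
/-- A vertex incident to no edge of `X` reaches only itself in `⟨X⟩`. [folklore] -/
theorem not_reachable_of_isolated {X : Finset (Sym2 V)} {v u : V} (hv : ∀ e ∈ X, v ∉ e)
    (huv : u ≠ v) : ¬(fromEdgeSet ((X : Finset (Sym2 V)) : Set (Sym2 V))).Reachable v u := by
  intro h
  rw [SimpleGraph.reachable_iff_reflTransGen] at h
  rcases Relation.ReflTransGen.cases_head h with hvu | ⟨c, hvc, _⟩
  · exact huv hvu.symm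
  · rw [fromEdgeSet_adj] at hvc
    exact hv _ (Finset.mem_coe.1 hvc.1) (Sym2.mem_mk_left v c)

/-- **Pendant edge.** If `v` is incident to no edge of the loop-free system `X` and `u ≠ v`, then
`⟨X ∪ vu⟩` is acyclic iff `⟨X⟩` is. [folklore] -/
theorem isAcyclic_insert_pendant_iff {X : Finset (Sym2 V)} (hX : ∀ e ∈ X, ¬e.IsDiag) {v u : V}
    (hv : ∀ e ∈ X, v ∉ e) (huv : u ≠ v) :
    (fromEdgeSet ((insert s(v, u) X : Finset (Sym2 V)) : Set (Sym2 V))).IsAcyclic ↔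
      (fromEdgeSet ((X : Finset (Sym2 V)) : Set (Sym2 V))).IsAcyclic := by
  have hnot : s(v, u) ∉ X := fun h => hv _ h (Sym2.mem_mk_left v u)
  rw [ForestExchange.isAcyclic_insert_iff hX huv.symm hnot]
  exact ⟨fun h => h.1, fun h => ⟨h, not_reachable_of_isolated hv huv⟩⟩

/-- **Re-routing along a present edge.** If `vu₁ ∈ X` then `⟨X ∪ vu₂⟩` is acyclic iff
`⟨X ∪ u₁u₂⟩` is (for `vu₂, u₁u₂ ∉ X`, all vertices distinct): both say `⟨X⟩` acyclic and `u₂` not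
joined to the common component of `v ~ u₁`. [folklore] -/
theorem isAcyclic_insert_reroute_iff {X : Finset (Sym2 V)} (hX : ∀ e ∈ X, ¬e.IsDiag)
    {v u₁ u₂ : V} (h₁ : s(v, u₁) ∈ X) (hvu₂ : v ≠ u₂) (hu : u₁ ≠ u₂) (h₂ : s(v, u₂) ∉ X)
    (hh : s(u₁, u₂) ∉ X) :
    (fromEdgeSet ((insert s(v, u₂) X : Finset (Sym2 V)) : Set (Sym2 V))).IsAcyclic ↔
      (fromEdgeSet ((insert s(u₁, u₂) X : Finset (Sym2 V)) : Set (Sym2 V))).IsAcyclic := by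
  have hvu₁ : v ≠ u₁ := fun h => hX _ h₁ (Sym2.mk_isDiag_iff.2 h)
  have hadj : (fromEdgeSet ((X : Finset (Sym2 V)) : Set (Sym2 V))).Adj v u₁ :=
    (fromEdgeSet_adj _).2 ⟨Finset.mem_coe.2 h₁, hvu₁⟩
  rw [ForestExchange.isAcyclic_insert_iff hX hvu₂ h₂, ForestExchange.isAcyclic_insert_iff hX hu hh]
  refine and_congr_right fun _ => not_congr ⟨fun h => ?_, fun h => ?_⟩
  · exact hadj.reachable.symm.trans h
  · exact hadj.reachable.trans h

/-- A loop-free edge system containing a triangle is not acyclic. [folklore] -/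
theorem not_isAcyclic_of_triangle {X : Finset (Sym2 V)} (hX : ∀ e ∈ X, ¬e.IsDiag) {a b c : V}
    (hab : s(a, b) ∈ X) (hbc : s(b, c) ∈ X) (hac : s(a, c) ∈ X) (h₁ : a ≠ b) (h₂ : b ≠ c)
    (h₃ : a ≠ c) : ¬(fromEdgeSet ((X : Finset (Sym2 V)) : Set (Sym2 V))).IsAcyclic := by
  intro hac'
  set Y := X.erase s(a, c) with hY
  have hYX : ∀ e ∈ Y, ¬e.IsDiag := fun e he => hX e (Finset.mem_of_mem_erase he)
  have hXY : X = insert s(a, c) Y := (Finset.insert_erase hac).symm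
  have habY : s(a, b) ∈ Y := by
    refine Finset.mem_erase.2 ⟨fun h => ?_, hab⟩
    have := Sym2.congr_right.1 h  -- b = c
    exact h₂ this
  have hbcY : s(b, c) ∈ Y := by
    refine Finset.mem_erase.2 ⟨fun h => ?_, hbc⟩
    rw [Sym2.eq_iff] at h
    rcases h with ⟨h, _⟩ | ⟨h, _⟩
    · exact h₁ h.symm
    · exact h₂ h
  rw [hXY] at hac'
  have key := (ForestExchange.isAcyclic_insert_iff hYX h₃ (Finset.notMem_erase _ _)).1 hac'
  apply key.2
  have e₁ : (fromEdgeSet ((Y : Finset (Sym2 V)) : Set (Sym2 V))).Adj a b :=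
    (fromEdgeSet_adj _).2 ⟨Finset.mem_coe.2 habY, h₁⟩
  have e₂ : (fromEdgeSet ((Y : Finset (Sym2 V)) : Set (Sym2 V))).Adj b c :=
    (fromEdgeSet_adj _).2 ⟨Finset.mem_coe.2 hbcY, h₂⟩
  exact e₁.reachable.trans e₂.reachable

/-! ### §3 The surgery facts for pinned forest partition functions -/

omit [Fintype V] in
/-- **Pinned set containing a cycle kills the partition function.** [elementary] -/
theorem forestsW_eq_zero_of_not_isAcyclic (w : Sym2 V → ℝ) (D K : Finset (Sym2 V))
    (hK : ¬(fromEdgeSet ((K : Finset (Sym2 V)) : Set (Sym2 V))).IsAcyclic) :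
    ∑ G ∈ D.powerset.filter (fun G =>
        (fromEdgeSet ((G ∪ K : Finset (Sym2 V)) : Set (Sym2 V))).IsAcyclic), ∏ g ∈ G, w g = 0 :=
  sum_pinned_eq_zero w
    (fun X : Finset (Sym2 V) => (fromEdgeSet ((X : Finset (Sym2 V)) : Set (Sym2 V))).IsAcyclic) D K
    fun _ _ hG => hK (isAcyclic_of_subset Finset.subset_union_right hG)

/-- **A pinned triangle kills the partition function.** [elementary] -/
theorem forestsW_eq_zero_of_triangle (w : Sym2 V → ℝ) (D K : Finset (Sym2 V))
    (hK : ∀ e ∈ K, ¬e.IsDiag) {a b c : V} (hab : s(a, b) ∈ K) (hbc : s(b, c) ∈ K)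
    (hac : s(a, c) ∈ K) (h₁ : a ≠ b) (h₂ : b ≠ c) (h₃ : a ≠ c) :
    ∑ G ∈ D.powerset.filter (fun G =>
        (fromEdgeSet ((G ∪ K : Finset (Sym2 V)) : Set (Sym2 V))).IsAcyclic), ∏ g ∈ G, w g = 0 :=
  forestsW_eq_zero_of_not_isAcyclic w D K (not_isAcyclic_of_triangle hK hab hbc hac h₁ h₂ h₃)

omit [Fintype V] in
/-- Nonnegativity of the pinned forest partition function for nonnegative activities.
[elementary] -/
theorem forestsW_nonneg (w : Sym2 V → ℝ) (hw : ∀ e, 0 ≤ w e) (D K : Finset (Sym2 V)) :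
    0 ≤ ∑ G ∈ D.powerset.filter (fun G =>
        (fromEdgeSet ((G ∪ K : Finset (Sym2 V)) : Set (Sym2 V))).IsAcyclic), ∏ x ∈ G, w x :=
  ConnMonotone.sum_pinned_nonneg w hw
    (fun X : Finset (Sym2 V) => (fromEdgeSet ((X : Finset (Sym2 V)) : Set (Sym2 V))).IsAcyclic) D K

omit [Fintype V] in
/-- Splitting off a free edge `g ∉ D`: `Z(D ∪ g;K) = Z(D;K) + w g · Z(D;K ∪ g)`. [elementary] -/
theorem forestsW_insert_split (w : Sym2 V → ℝ) (D K : Finset (Sym2 V)) {g : Sym2 V} (hg : g ∉ D) :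
    ∑ G ∈ (insert g D).powerset.filter (fun G =>
        (fromEdgeSet ((G ∪ K : Finset (Sym2 V)) : Set (Sym2 V))).IsAcyclic), ∏ x ∈ G, w x =
      ∑ G ∈ D.powerset.filter (fun G =>
        (fromEdgeSet ((G ∪ K : Finset (Sym2 V)) : Set (Sym2 V))).IsAcyclic), ∏ x ∈ G, w x +
      w g * ∑ G ∈ D.powerset.filter (fun G =>
        (fromEdgeSet ((G ∪ insert g K : Finset (Sym2 V)) : Set (Sym2 V))).IsAcyclic), ∏ x ∈ G, w x :=
  sum_pinned_insert_split w
    (fun X : Finset (Sym2 V) => (fromEdgeSet ((X : Finset (Sym2 V)) : Set (Sym2 V))).IsAcyclic) D K hg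

omit [Fintype V] in
/-- Re-weighting an edge outside the free set does not change `Z(D;K)`. [elementary] -/
theorem forestsW_update (w : Sym2 V → ℝ) (D K : Finset (Sym2 V)) (h : Sym2 V) (c : ℝ)
    (hh : h ∉ D) :
    ∑ G ∈ D.powerset.filter (fun G =>
        (fromEdgeSet ((G ∪ K : Finset (Sym2 V)) : Set (Sym2 V))).IsAcyclic),
        ∏ x ∈ G, Function.update w h c x =
      ∑ G ∈ D.powerset.filter (fun G =>
        (fromEdgeSet ((G ∪ K : Finset (Sym2 V)) : Set (Sym2 V))).IsAcyclic), ∏ x ∈ G, w x :=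
  sum_pinned_update w
    (fun X : Finset (Sym2 V) => (fromEdgeSet ((X : Finset (Sym2 V)) : Set (Sym2 V))).IsAcyclic)
    D K h c hh

omit [Fintype V] in
/-- **Pinning more edges only loses** (nonnegative activities): `Z(D;K ∪ g) ≤ Z(D;K)`.
[elementary] -/
theorem forestsW_insert_pin_le (w : Sym2 V → ℝ) (hw : ∀ e, 0 ≤ w e) (D K : Finset (Sym2 V))
    (g : Sym2 V) :
    ∑ G ∈ D.powerset.filter (fun G =>
        (fromEdgeSet ((G ∪ insert g K : Finset (Sym2 V)) : Set (Sym2 V))).IsAcyclic), ∏ x ∈ G, w x ≤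
      ∑ G ∈ D.powerset.filter (fun G =>
        (fromEdgeSet ((G ∪ K : Finset (Sym2 V)) : Set (Sym2 V))).IsAcyclic), ∏ x ∈ G, w x :=
  sum_pinned_mono w hw
    (fun X : Finset (Sym2 V) => (fromEdgeSet ((X : Finset (Sym2 V)) : Set (Sym2 V))).IsAcyclic) D K (insert g K)
    fun G _ hG =>
    isAcyclic_of_subset (Finset.union_subset_union (subset_refl G) (Finset.subset_insert g K)) hG

/-- **Pinned pendant edge is irrelevant.** If `v` meets no edge of `D ∪ K` and `u ≠ v` then
`Z(D;K ∪ vu) = Z(D;K)`. [elementary] -/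
theorem forestsW_pin_pendant (w : Sym2 V → ℝ) (D K : Finset (Sym2 V))
    (hDK : ∀ e ∈ D ∪ K, ¬e.IsDiag) {v u : V} (hv : ∀ e ∈ D ∪ K, v ∉ e) (huv : u ≠ v) :
    ∑ G ∈ D.powerset.filter (fun G =>
        (fromEdgeSet ((G ∪ insert s(v, u) K : Finset (Sym2 V)) : Set (Sym2 V))).IsAcyclic),
        ∏ x ∈ G, w x =
      ∑ G ∈ D.powerset.filter (fun G =>
        (fromEdgeSet ((G ∪ K : Finset (Sym2 V)) : Set (Sym2 V))).IsAcyclic), ∏ x ∈ G, w x := by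
  apply sum_pinned_congr w
    (fun X : Finset (Sym2 V) => (fromEdgeSet ((X : Finset (Sym2 V)) : Set (Sym2 V))).IsAcyclic) D (insert s(v, u) K) K
  intro G hGD
  have hGK : G ∪ K ⊆ D ∪ K := Finset.union_subset_union hGD (subset_refl K)
  rw [Finset.union_insert]
  exact isAcyclic_insert_pendant_iff (fun e he => hDK e (hGK he)) (fun e he => hv e (hGK he)) huv

/-- **Free pendant edge gives a factor `1 + w`.** If `v` meets no edge of `D ∪ K`, `u ≠ v`, then
`Z(D ∪ vu;K) = (1 + w(vu)) · Z(D;K)`. [elementary] -/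
theorem forestsW_free_pendant (w : Sym2 V → ℝ) (D K : Finset (Sym2 V))
    (hDK : ∀ e ∈ D ∪ K, ¬e.IsDiag) {v u : V} (hv : ∀ e ∈ D ∪ K, v ∉ e) (huv : u ≠ v) :
    ∑ G ∈ (insert s(v, u) D).powerset.filter (fun G =>
        (fromEdgeSet ((G ∪ K : Finset (Sym2 V)) : Set (Sym2 V))).IsAcyclic), ∏ x ∈ G, w x =
      (1 + w s(v, u)) * ∑ G ∈ D.powerset.filter (fun G =>
        (fromEdgeSet ((G ∪ K : Finset (Sym2 V)) : Set (Sym2 V))).IsAcyclic), ∏ x ∈ G, w x := by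
  have hg : s(v, u) ∉ D := fun h => hv _ (Finset.mem_union_left K h) (Sym2.mem_mk_left v u)
  apply sum_pinned_insert_free w
    (fun X : Finset (Sym2 V) => (fromEdgeSet ((X : Finset (Sym2 V)) : Set (Sym2 V))).IsAcyclic) D K hg
  intro G hGD
  have hGK : G ∪ K ⊆ D ∪ K := Finset.union_subset_union hGD (subset_refl K)
  rw [Finset.union_insert]
  exact isAcyclic_insert_pendant_iff (fun e he => hDK e (hGK he)) (fun e he => hv e (hGK he)) huv

/-- **Re-routing a second edge at a vertex whose first edge is pinned.** If `vu₁ ∈ K` and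
`vu₂, u₁u₂ ∉ D ∪ K` (vertices distinct) then `Z(D;K ∪ vu₂) = Z(D;K ∪ u₁u₂)`. [elementary] -/
theorem forestsW_pin_reroute (w : Sym2 V → ℝ) (D K : Finset (Sym2 V))
    (hDK : ∀ e ∈ D ∪ K, ¬e.IsDiag) {v u₁ u₂ : V} (h₁ : s(v, u₁) ∈ K) (hvu₂ : v ≠ u₂)
    (hu : u₁ ≠ u₂) (h₂ : s(v, u₂) ∉ D ∪ K) (hh : s(u₁, u₂) ∉ D ∪ K) :
    ∑ G ∈ D.powerset.filter (fun G =>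
        (fromEdgeSet ((G ∪ insert s(v, u₂) K : Finset (Sym2 V)) : Set (Sym2 V))).IsAcyclic),
        ∏ x ∈ G, w x =
      ∑ G ∈ D.powerset.filter (fun G =>
        (fromEdgeSet ((G ∪ insert s(u₁, u₂) K : Finset (Sym2 V)) : Set (Sym2 V))).IsAcyclic),
        ∏ x ∈ G, w x := by
  apply sum_pinned_congr w
    (fun X : Finset (Sym2 V) => (fromEdgeSet ((X : Finset (Sym2 V)) : Set (Sym2 V))).IsAcyclic)
    D (insert s(v, u₂) K) (insert s(u₁, u₂) K)
  intro G hGD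
  have hGK : G ∪ K ⊆ D ∪ K := Finset.union_subset_union hGD (subset_refl K)
  rw [Finset.union_insert, Finset.union_insert]
  exact isAcyclic_insert_reroute_iff (fun e he => hDK e (hGK he)) (Finset.mem_union_right G h₁)
    hvu₂ hu (fun h => h₂ (hGK h)) (fun h => hh (hGK h))

end Forests

end Summit.CriticalPhenomena.PercolationContinuityZ3.Theorems.ForestRayleigh
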